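import Summits.BirchSwinnertonDyer.Rank1Residual.Supersingular.PadicRootCensusSieve
import Mathlib.FieldTheory.Finite.Basic
import HarnessLib

/-!
# Root census v4: the sieved residue tree with the NEWTON DIGIT — `RootCensusSieve.check₃` with one
# accelerated `Nat.pow` instead of `p` evaluations of the sieve polynomial wherever it is linear
# (cell `b2b-bsdres`, supersingular family, prover A = unit `b2b-bsdres-x10b`, gen 23 — TOOL, pure
# `p`-adic algebra; sequel of `Supersingular/PadicRootCensusSieve`)

HONEST FRAMING (cell `b2b-bsdres`, run/shared/lean/b2b/bsd-rank1-residual/, verbatim in every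
file): the goal of the cell is to DELETE the COMBINATION-SHAPED residual classes of the
Birch–Swinnerton-Dyer formula for ALL analytic-rank `≤ 1` elliptic curves over `ℚ` — "full BSD
formula for every rank `≤ 1` curve in class `C`" assembled STRICTLY from published theorems — so
that the rank-`≤ 1` remainder becomes exactly the CONSTRUCTION-SHAPED classes, which are TYPED
(missing-input `Prop`s), NOT attempted. This is not "finishing BSD". This file is a TOOL; nothing is
booked by it; no mark / label / count moved. No named fact, no `sorry`; the only definitions are
COMPUTABLE bookkeeping (the Boolean checker `check₄` and its parts).

## Why a fourth checker

`RootCensusSieve.check₃` sieves the `p` children of an alive class by the reduced scaled Taylor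
polynomial `ḡ` — `p` evaluations of a degree-`≤ 12` integer polynomial per parent and level. Below
Hensel precision along a simple root (the `13` levels before the ball of `x(q^{2/5})` absorbs, at the
`ℓ = 587` place of the visibility partner of 481574k1) `ḡ` is LINEAR with a unit slope, and the one
surviving digit is the NEWTON DIGIT `t₀ ≡ −d₀·d₁^{p−2} (mod p)`: one accelerated `Nat.pow` replaces the
`p` evaluations. Measured: with `check₃` that certificate passes `decide +kernel` in the record file's
own import closure but runs the kernel out of memory inside the larger closure of a consumer twin;
with `check₄` both take `≈ 20 s`. The certificate format and the census theorem are unchanged.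

## What

`linearDigit`, `childDigitsN`, `frontierStep₄`, `coverTree₄`, `coverOK₄`, `check₄` (definitions; `sieveList`,
`deadDeep`, `alive₃`, `entryOK`, `pairwiseOK` are the tree's) and the soundness chain
`eq_of_linearDigit` (Fermat in `ZMod p`), `mem_childDigitsN_of_root`, `inBall_of_coverTree₄`,
`inBall_of_coverOK₄`, **`exists_roots_of_check₄`** — the census theorem in exactly the shape of
`exists_roots_of_check₂` / `exists_roots_of_check₃` (via n1011's generic core `exists_roots_of_cover`).

References: standard (Hensel's lemma, Newton's method, Fermat's little theorem — Mathlib).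
-/

set_option autoImplicit false

open Polynomial
open Summit.BirchSwinnertonDyer.Rank1Residual.GaloisImage.RootCensus
open Summit.BirchSwinnertonDyer.Rank1Residual.Supersingular.RootCensusSieve

namespace Summit.BirchSwinnertonDyer.Rank1Residual.Supersingular.RootCensusNewton

/-! ### §1 Definitions -/

/-- **Newton digit.** When the reduced sieve polynomial is LINEAR with a unit slope — `ds = d₀ :: d₁ :: rest`,
every entry of `rest` divisible by `p`, `p ∤ d₁` — the unique digit `t₀ ≡ −d₀ · d₁^{p−2} (mod p)` (Fermat
inverse; one accelerated `Nat.pow`), else `none`. This is the generic situation below Hensel precision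
along a simple root, where it replaces `p` evaluations of `ḡ` by one. [folklore] -/
def linearDigit (p : ℕ) : List ℤ → Option ℕ
  | d₀ :: d₁ :: rest =>
    if (rest.all fun c => c % (p : ℤ) == 0) && !(d₁ % (p : ℤ) == 0) then
      some ((((p : ℤ) - d₀ % (p : ℤ)) % (p : ℤ)).toNat * (d₁ % (p : ℤ)).toNat ^ (p - 2) % p)
    else none
  | _ => none

/-- The child digits of the class `r (mod p^j)` that may still contain a root of `F` (v4): the Newton
digit alone when the sieve polynomial is linear with unit slope, else `RootCensusSieve`'s sieved
digits (all `t < p` if there is no sieve). [folklore] -/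
def childDigitsN (p : ℕ) (l : List ℤ) (j : ℕ) (r : ℤ) : List ℕ :=
  match sieveList p l j r with
  | none => List.range p
  | some ds =>
    match linearDigit p ds with
    | some t₀ => [t₀]
    | none => (List.range p).filter fun t : ℕ => evalList ds (t : ℤ) % (p : ℤ) == 0

/-- One level of the v4 residue tree. [folklore] -/
def frontierStep₄ (p : ℕ) (l : List ℤ) (cert : List (ℤ × ℕ × ℕ)) (j : ℕ) (fr : List ℤ) :
    List ℤ :=
  fr.flatMap fun r =>
    ((childDigitsN p l j r).map fun t : ℕ => r + (t : ℤ) * (p : ℤ) ^ j).filter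
      (alive₃ p l cert (j + 1))

/-- The v4 tree search. [folklore] -/
def coverTree₄ (p : ℕ) (l : List ℤ) (cert : List (ℤ × ℕ × ℕ)) : ℕ → ℕ → List ℤ → Bool
  | 0, _, fr => fr.isEmpty
  | fuel + 1, j, fr => fr.isEmpty || coverTree₄ p l cert fuel (j + 1) (frontierStep₄ p l cert j fr)

/-- The v4 residue check. [folklore] -/
def coverOK₄ (p : ℕ) (l : List ℤ) (k : ℕ) (cert : List (ℤ × ℕ × ℕ)) : Bool :=
  coverTree₄ p l cert k 0 [0]

/-- **The v4 root-census checker** (entries + disjointness as in `check`; sieved residue search with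
the Newton digit and the deep Taylor exclusion test). [folklore] -/
def check₄ (p : ℕ) (l : List ℤ) (k : ℕ) (cert : List (ℤ × ℕ × ℕ)) : Bool :=
  cert.all (entryOK p l k) && pairwiseOK p cert && coverOK₄ p l k cert

variable {p : ℕ} [hp : Fact p.Prime]

/-! ### §2 Soundness of the Newton digit -/

/-- A list all of whose entries are divisible by `p` evaluates to `0` in `ZMod p`. [folklore] -/
theorem intCast_evalList_eq_zero_of_all_dvd (x : ℤ) :
    ∀ l : List ℤ, (∀ c ∈ l, (p : ℤ) ∣ c) → ((evalList l x : ℤ) : ZMod p) = 0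
  | [], _ => by simp [evalList]
  | c :: l, h => by
    have hc : ((c : ℤ) : ZMod p) = 0 := (ZMod.intCast_zmod_eq_zero_iff_dvd c p).mpr (h c (by simp))
    have ih := intCast_evalList_eq_zero_of_all_dvd x l fun c' hc' => h c' (by simp [hc'])
    simp only [evalList, Int.cast_add, Int.cast_mul, hc, ih, mul_zero, add_zero]

/-- **Soundness of the Newton digit**: if `linearDigit p ds = some t₀` then the only digit `t < p` with
`p ∣ ḡ(t)` is `t₀` (`ḡ(t) ≡ d₀ + d₁ t (mod p)`, `d₁` a unit, Fermat `d₁^{p-1} ≡ 1`). [folklore] -/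
theorem eq_of_linearDigit {ds : List ℤ} {t₀ : ℕ} (h : linearDigit p ds = some t₀) {t : ℕ} (htp : t < p)
    (hdvd : (p : ℤ) ∣ evalList ds t) : t = t₀ := by
  unfold linearDigit at h
  split at h
  · rename_i d₀ d₁ rest
    split_ifs at h with hc
    simp only [Option.some.injEq] at h
    rw [Bool.and_eq_true, List.all_eq_true, Bool.not_eq_true', beq_eq_false_iff_ne, ne_eq,
      emod_eq_zero_iff_dvd'] at hc
    obtain ⟨hrest, hd₁⟩ := hc
    have hp := hp.out
    have hp0 : (0 : ℤ) < p := by exact_mod_cast hp.pos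
    have hpne : (p : ℤ) ≠ 0 := hp0.ne'
    haveI : NeZero p := ⟨hp.ne_zero⟩
    -- in `ZMod p`: `d₀ + t d₁ = 0`
    have hrest' : ∀ c ∈ rest, (p : ℤ) ∣ c := fun c hc => by
      have := hrest c hc; rwa [beq_iff_eq, emod_eq_zero_iff_dvd'] at this
    have hE : ((evalList (d₀ :: d₁ :: rest) t : ℤ) : ZMod p) = 0 :=
      (ZMod.intCast_zmod_eq_zero_iff_dvd _ p).mpr hdvd
    simp only [evalList, Int.cast_add, Int.cast_mul, Int.cast_natCast,
      intCast_evalList_eq_zero_of_all_dvd (t : ℤ) rest hrest', mul_zero, add_zero] at hE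
    -- the unit `d₁` and Fermat
    have hd₁' : ((d₁ : ℤ) : ZMod p) ≠ 0 := fun h0 =>
      hd₁ ((ZMod.intCast_zmod_eq_zero_iff_dvd d₁ p).mp h0)
    have hF : ((d₁ : ℤ) : ZMod p) ^ (p - 1) = 1 := ZMod.pow_card_sub_one_eq_one hd₁'
    -- the casts of the two `toNat`s
    have ha : ((((d₁ % (p : ℤ)).toNat : ℕ) : ℤ) : ZMod p) = ((d₁ : ℤ) : ZMod p) := by
      rw [Int.toNat_of_nonneg (Int.emod_nonneg _ hpne), ZMod.intCast_mod]
    have hb : ((((((p : ℤ) - d₀ % (p : ℤ)) % (p : ℤ)).toNat : ℕ) : ℤ) : ZMod p) = -((d₀ : ℤ) : ZMod p) := by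
      rw [Int.toNat_of_nonneg (Int.emod_nonneg _ hpne), ZMod.intCast_mod, Int.cast_sub, ZMod.intCast_mod,
        Int.cast_natCast, ZMod.natCast_self, zero_sub]
    -- `t ≡ t₀ (mod p)`
    have ht₀p : t₀ < p := by rw [← h]; exact Nat.mod_lt _ hp.pos
    have key : ((t : ℕ) : ZMod p) = ((t₀ : ℕ) : ZMod p) := by
      have h1 : ((t₀ : ℕ) : ZMod p) = -((d₀ : ℤ) : ZMod p) * ((d₁ : ℤ) : ZMod p) ^ (p - 2) := by
        rw [← h, ZMod.natCast_mod, Nat.cast_mul, Nat.cast_pow, ← Int.cast_natCast (R := ZMod p),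
          ← Int.cast_natCast (R := ZMod p) ((d₁ % (p : ℤ)).toNat), ha, hb]
      have h2 : ((t : ℕ) : ZMod p) * ((d₁ : ℤ) : ZMod p) = -((d₀ : ℤ) : ZMod p) := by
        linear_combination hE
      have hp2 : p - 2 + 1 = p - 1 := by have := hp.two_le; omega
      calc ((t : ℕ) : ZMod p)
          = ((t : ℕ) : ZMod p) * (((d₁ : ℤ) : ZMod p) * ((d₁ : ℤ) : ZMod p) ^ (p - 2)) := by
            rw [← pow_succ', hp2, hF, mul_one]
        _ = -((d₀ : ℤ) : ZMod p) * ((d₁ : ℤ) : ZMod p) ^ (p - 2) := by rw [← mul_assoc, h2]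
        _ = ((t₀ : ℕ) : ZMod p) := h1.symm
    rw [ZMod.natCast_eq_natCast_iff'] at key
    rwa [Nat.mod_eq_of_lt htp, Nat.mod_eq_of_lt ht₀p] at key
  · simp at h

/-- **The digit of a root survives the v4 sieve**: for a root `z` of `F` in the class of `r (mod p^j)`
with digit `t < p` at level `j`, `t ∈ childDigitsN p l j r`. [folklore] -/
theorem mem_childDigitsN_of_root {l : List ℤ} {j : ℕ} {r : ℤ} {z : ℤ_[p]}
    (hz0 : aeval z (ofList l) = 0) (hzr : ‖z - (r : ℤ_[p])‖ ≤ (p : ℝ) ^ (-(j : ℤ))) {t : ℕ}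
    (htp : t < p)
    (hzt : ‖z - ((r + (t : ℤ) * (p : ℤ) ^ j : ℤ) : ℤ_[p])‖ ≤ (p : ℝ) ^ (-((j + 1 : ℕ) : ℤ))) :
    t ∈ childDigitsN p l j r := by
  unfold childDigitsN
  split
  · exact List.mem_range.mpr htp
  · rename_i ds hs
    have hd := dvd_evalList_of_root hs hz0 hzr hzt
    split
    · rename_i t₀ ht₀
      exact List.mem_singleton.mpr (eq_of_linearDigit ht₀ htp hd)
    · refine List.mem_filter.mpr ⟨List.mem_range.mpr htp, ?_⟩
      rw [beq_iff_eq]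
      exact Int.emod_eq_zero_of_dvd hd

/-! ### §3 Soundness of the v4 tree search and the census theorem -/

/-- What `alive₃ … = false` means for a residue carrying `F ≡ 0` and a root in its class: it is in
a ball. -/
private theorem inBall_of_not_alive₃ {l : List ℤ} {cert : List (ℤ × ℕ × ℕ)} {j : ℕ} {r : ℤ}
    (hF : (p : ℤ) ^ j ∣ evalList l r) {z : ℤ_[p]} (hz0 : aeval z (ofList l) = 0)
    (hz : ‖z - (r : ℤ_[p])‖ ≤ (p : ℝ) ^ (-(j : ℤ))) (ha : alive₃ p l cert j r = false) :
    ∃ e ∈ cert, e.2.1 + 1 ≤ j ∧ (p : ℤ) ^ (e.2.1 + 1) ∣ r - e.1 := by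
  have hnd : deadDeep p l j r = false := by
    by_contra hd
    rw [Bool.not_eq_false] at hd
    exact aeval_ne_zero_of_deadDeep hd hz hz0
  simp only [alive₃, hnd, Bool.not_false, Bool.and_true, Bool.and_eq_false_imp, beq_iff_eq,
    emod_eq_zero_iff_dvd', Bool.not_eq_false', inBall, List.any_eq_true, Bool.and_eq_true,
    decide_eq_true_eq] at ha
  exact ha hF |>.imp fun e he => ⟨he.1, he.2.1, he.2.2⟩

/-- **Soundness of the v3 tree search** (FILE A1b's `inBall_of_coverTree₂` with the sieved children:
the digit of a root always survives the sieve, `mem_childDigitsN_of_root`). [folklore] -/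
theorem inBall_of_coverTree₄ (l : List ℤ) (cert : List (ℤ × ℕ × ℕ)) :
    ∀ (fuel j : ℕ) (fr : List ℤ), coverTree₄ p l cert fuel j fr = true →
      (∀ z : ℤ_[p], aeval z (ofList l) = 0 →
        (∀ e ∈ cert, ¬ ‖z - (e.1 : ℤ_[p])‖ ≤ (p : ℝ) ^ (-((e.2.1 + 1 : ℕ) : ℤ))) →
        ∃ r ∈ fr, ‖z - (r : ℤ_[p])‖ ≤ (p : ℝ) ^ (-(j : ℤ))) →
      ∀ z : ℤ_[p], aeval z (ofList l) = 0 →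
        ∃ e ∈ cert, ‖z - (e.1 : ℤ_[p])‖ ≤ (p : ℝ) ^ (-((e.2.1 + 1 : ℕ) : ℤ)) := by
  intro fuel
  induction fuel with
  | zero =>
    intro j fr h hinv z hz
    by_contra hne
    simp only [not_exists, not_and] at hne
    obtain ⟨r, hr, -⟩ := hinv z hz hne
    simp only [coverTree₄, List.isEmpty_iff] at h
    rw [h] at hr; exact absurd hr (by simp)
  | succ fuel ih =>
    intro j fr h hinv z hz
    by_contra hne
    simp only [not_exists, not_and] at hne
    simp only [coverTree₄, Bool.or_eq_true, List.isEmpty_iff] at h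
    rcases h with h | h
    · obtain ⟨r, hr, -⟩ := hinv z hz hne
      rw [h] at hr; exact absurd hr (by simp)
    · suffices hinv' : ∀ z' : ℤ_[p], aeval z' (ofList l) = 0 →
          (∀ e ∈ cert, ¬ ‖z' - (e.1 : ℤ_[p])‖ ≤ (p : ℝ) ^ (-((e.2.1 + 1 : ℕ) : ℤ))) →
          ∃ r ∈ frontierStep₄ p l cert j fr, ‖z' - (r : ℤ_[p])‖ ≤ (p : ℝ) ^ (-((j + 1 : ℕ) : ℤ)) by
        obtain ⟨e, he, hP⟩ := ih (j + 1) _ h (by exact_mod_cast hinv') z hz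
        exact hne e he hP
      intro z' hz' hne'
      obtain ⟨r, hr, hzr⟩ := hinv z' hz' hne'
      obtain ⟨t, htp, hzt⟩ := exists_digit hzr
      refine ⟨r + (t : ℤ) * (p : ℤ) ^ j, ?_, hzt⟩
      have hF : (p : ℤ) ^ (j + 1) ∣ evalList l (r + (t : ℤ) * (p : ℤ) ^ j) := by
        have h1 := padic_polynomial_dist (ofList l) (((r + (t : ℤ) * (p : ℤ) ^ j : ℤ)) : ℤ_[p]) z'
        rw [hz', sub_zero, aeval_intCast_ofList] at h1
        exact PadicInt.norm_int_le_pow_iff_dvd.mp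
          (h1.trans (by rw [← norm_neg, neg_sub]; exact hzt))
      have halive : alive₃ p l cert (j + 1) (r + (t : ℤ) * (p : ℤ) ^ j) = true := by
        by_contra ha
        rw [Bool.not_eq_true] at ha
        obtain ⟨e, he, hej, hdvd⟩ := inBall_of_not_alive₃ hF hz' hzt ha
        apply hne' e he
        have hp1 : (1 : ℝ) ≤ p := by exact_mod_cast hp.out.one_lt.le
        have hrc : ‖(((r + (t : ℤ) * (p : ℤ) ^ j : ℤ)) : ℤ_[p]) - (e.1 : ℤ_[p])‖ ≤
            (p : ℝ) ^ (-((e.2.1 + 1 : ℕ) : ℤ)) := by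
          rw [← Int.cast_sub]; exact norm_intCast_le_of_dvd hdvd
        calc ‖z' - (e.1 : ℤ_[p])‖
            = ‖(z' - (((r + (t : ℤ) * (p : ℤ) ^ j : ℤ)) : ℤ_[p])) +
                ((((r + (t : ℤ) * (p : ℤ) ^ j : ℤ)) : ℤ_[p]) - (e.1 : ℤ_[p]))‖ := by ring_nf
          _ ≤ max ‖z' - (((r + (t : ℤ) * (p : ℤ) ^ j : ℤ)) : ℤ_[p])‖
                ‖(((r + (t : ℤ) * (p : ℤ) ^ j : ℤ)) : ℤ_[p]) - (e.1 : ℤ_[p])‖ :=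
              PadicInt.nonarchimedean _ _
          _ ≤ (p : ℝ) ^ (-((e.2.1 + 1 : ℕ) : ℤ)) :=
              max_le (hzt.trans (zpow_le_zpow_right₀ hp1 (by push_cast; omega))) hrc
      exact List.mem_flatMap.mpr ⟨r, hr, List.mem_filter.mpr
        ⟨List.mem_map.mpr ⟨t, mem_childDigitsN_of_root hz' hzr htp hzt, rfl⟩, halive⟩⟩

/-- What `coverOK₄` certifies: every root of `F` in `ℤ_p` lies in a certified ball. [folklore] -/
theorem inBall_of_coverOK₄ {l : List ℤ} {k : ℕ} {cert : List (ℤ × ℕ × ℕ)}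
    (h : coverOK₄ p l k cert = true) (z : ℤ_[p]) (hz : aeval z (ofList l) = 0) :
    ∃ e ∈ cert, ‖z - (e.1 : ℤ_[p])‖ ≤ (p : ℝ) ^ (-((e.2.1 + 1 : ℕ) : ℤ)) :=
  inBall_of_coverTree₄ l cert k 0 [0] h
    (fun z _ _ => ⟨0, List.mem_singleton.mpr rfl, by simpa using PadicInt.norm_le_one z⟩) z hz

/-- **ROOT CENSUS for the v4 checker** (the shape of `exists_roots_of_check₂` / `exists_roots_of_check₃`): if
`check₄ p l k cert = true` then `F = ofList l` has EXACTLY `cert.length` roots in `ℤ_p`, pairwise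
distinct, the `i`-th one in the certified ball of the `i`-th entry `(cᵢ, mᵢ, Nᵢ)` at distance
`< p^{-mᵢ}` and `≤ p^{-(Nᵢ - mᵢ)}` from `cᵢ`. [folklore] -/
theorem exists_roots_of_check₄ (l : List ℤ) (k : ℕ) (cert : List (ℤ × ℕ × ℕ))
    (h : check₄ p l k cert = true) :
    ∃ ρ : Fin cert.length → ℤ_[p], Function.Injective ρ ∧
      (∀ i, aeval (ρ i) (ofList l) = 0 ∧
        ‖ρ i - ((cert.get i).1 : ℤ_[p])‖ < (p : ℝ) ^ (-((cert.get i).2.1 : ℤ)) ∧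
        ‖ρ i - ((cert.get i).1 : ℤ_[p])‖ ≤
          (p : ℝ) ^ (-(((cert.get i).2.2 - (cert.get i).2.1 : ℕ) : ℤ))) ∧
      ∀ z : ℤ_[p], aeval z (ofList l) = 0 → ∃ i, ρ i = z := by
  simp only [check₄, Bool.and_eq_true, List.all_eq_true] at h
  obtain ⟨⟨hent, hpw⟩, hcov⟩ := h
  exact exists_roots_of_cover l k cert hent hpw (inBall_of_coverOK₄ hcov)

/-- Sanity check of the kernel evaluation: `X² − 7` over `ℤ₃` (the two roots `≡ ±1 (mod 3)`).
[folklore] -/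
example : check₄ 3 [-7, 0, 1] 1 [((1 : ℤ), 0, 1), (-1, 0, 1)] = true := by decide

end Summit.BirchSwinnertonDyer.Rank1Residual.Supersingular.RootCensusNewton
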